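import Summits.PneNP.PneNP.Theses.RamseyUncertifiable
import Literature.Combinatorics.SimpleGraph.RamseyNumbers
import Literature.Computability.Complexity.HamCircuitNP
import Literature.Computability.Complexity.FinitePatching
import Literature.Computability.Complexity.LengthCompare
import Literature.Computability.Complexity.BranchingFn
import Literature.Computability.Complexity.NPClosureProofs

/-!
# `RamseyNotNP` (stmt-PneNP-9814, route PneNP/RamseyUncertifiable) — negative-side lemmas: the threshold is load-bearing

Standing-adversary (cdisprove, gen 1) output for the crux
`Summit.PneNP.PneNP.Theses.RamseyUncertifiable.RamseyNotNP`
(`RAMSEY₂ := encodingGraph.toLanguage {⟨n, G⟩ | G.CliqueFree ⌈log₂ n²⌉ ∧ Gᶜ.CliqueFree ⌈log₂ n²⌉} ∉ NP`).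
The crux is NOT refuted and NOT mis-stated: its negation is literally `RAMSEY₂ ∈ NP` (polynomial-size
certificates of Ramsey-ness for every Ramsey graph at the Erdős threshold — open), and the crux implies
`coNP ≠ NP` (companion file `Sandwich.lean`).  This file records, as theorems over the crux SHAPE
`RamseyNotNPAt k` (`RAMSEY_k ∉ NP` at an arbitrary threshold function `k`; the crux is `k = thr`,
`thr n = Nat.clog 2 (n²)`, `ramseyNotNP_iff`), which thresholds are dead and what the crux is equivalent to:

* §0 read-back and membership sanity (`thr` values; sizes `≤ 2` contribute nothing, size `3` everything,
  `K_n` for `n ≥ 4` is out).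
* §2 `not_ramseyNotNPAt_of_fourPow` — `4^{k n} ≤ n` eventually ⟹ the language is FINITE (Erdős–Szekeres,
  tree fact `ramsey_diagonal_le_four_pow_holds`) ⟹ in `P ⊆ NP`; constant thresholds, `⌊log₄ n⌋`,
  `⌊log₂ n⌋/2` are refuted: the `2` of `2 log₂ n` cannot drop to `1/2`.
* §3 `not_ramseyNotNPAt_of_lt` — `n < k n` ⟹ the language is the code-word language, in `P`
  (`HamNP.gcodeLang_mem_P`).
* §4 `mem_NP_of_finite_modification`, `ramseyNotNPAt_congr` — only the eventual threshold matters.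
* §5 `infinite_of_ramseyNotNPAt`, `coinfinite_of_ramseyNotNPAt` — necessary conditions (met at `thr`:
  `Sandwich.lean`).
* §7 `ramseyNotNPAt_iff_forall_NP_misses_infinite` — INSTANCE FORM: the crux ⟺ every `NP` family of codes
  of Ramsey graphs misses infinitely many Ramsey graphs; `not_forall_threshold`.

Crux work file: `Cruxes/RamseyNotNP/Disproof.lean` (also: immunity-type strengthenings = negation of
Erdős' explicit-construction problem — open, not to be adopted).  Refuter seat cdisprove-stmt-PneNP-9814,
2026-08-16.
-/

-- `Summit.PneNP.PneNP.…` duplicates `PneNP` BY DESIGN (single-problem summit, D-0017).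
set_option linter.dupNamespace false

namespace Summit.PneNP.PneNP.Theorems.RamseyNotNP.Negative

open Literature.Computability.Complexity _root_.Computability
open Summit.PneNP.PneNP.Theses.RamseyUncertifiable (RamseyNotNP)

/-! ## §0 Read-back and sanity -/

/-- The Ramsey set at a threshold function `k`: graphs `⟨n, G⟩` with no clique and no independent set
of size `k n`. [folklore] -/
def ramseySetAt (k : ℕ → ℕ) : Set (Σ n, SimpleGraph (Fin n)) :=
  {p | p.2.CliqueFree (k p.1) ∧ p.2ᶜ.CliqueFree (k p.1)}

/-- Its language of adjacency code words. [folklore] -/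
def ramseyLangAt (k : ℕ → ℕ) : Language Bool :=
  encodingGraph.toLanguage (ramseySetAt k)

/-- The crux shape at threshold `k`: `RAMSEY_k ∉ NP`. [folklore] -/
def RamseyNotNPAt (k : ℕ → ℕ) : Prop :=
  ramseyLangAt k ∉ Nondeterministic.NP

/-- The crux threshold `⌈log₂ (n²)⌉ = ⌈2 log₂ n⌉`. [folklore] -/
def thr (n : ℕ) : ℕ := Nat.clog 2 (n ^ 2)

/-- **Read-back.** The crux is `RamseyNotNPAt thr`, definitionally. [folklore] -/
theorem ramseyNotNP_iff : RamseyNotNP ↔ RamseyNotNPAt thr := Iff.rfl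

/-- The language of the crux is `ramseyLangAt thr`, definitionally. [folklore] -/
theorem ramseyLang_thr_eq :
    ramseyLangAt thr = encodingGraph.toLanguage {p : Σ n, SimpleGraph (Fin n) |
      p.2.CliqueFree (Nat.clog 2 (p.1 ^ 2)) ∧ p.2ᶜ.CliqueFree (Nat.clog 2 (p.1 ^ 2))} := rfl

/-- Small values of the threshold: `thr n = ⌈2 log₂ n⌉`. [folklore] -/
theorem thr_values : thr 0 = 0 ∧ thr 1 = 0 ∧ thr 2 = 2 ∧ thr 3 = 4 ∧ thr 4 = 4 ∧ thr 5 = 5 ∧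
    thr 6 = 6 ∧ thr 7 = 6 ∧ thr 8 = 6 ∧ thr 9 = 7 ∧ thr 11 = 7 ∧ thr 12 = 8 ∧ thr 16 = 8 ∧ thr 17 = 9 := by
  decide

/-- Dyadic sizes: `thr (2^m) = 2m`. [folklore] -/
theorem thr_two_pow (m : ℕ) : thr (2 ^ m) = 2 * m := by
  unfold thr
  rw [← pow_mul, Nat.clog_pow 2 _ one_lt_two, mul_comm]

/-- `thr n ≤ n` for `n ≥ 4` (as `n² ≤ 2ⁿ`). [folklore] -/
theorem thr_le_self {n : ℕ} (hn : 4 ≤ n) : thr n ≤ n := by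
  unfold thr
  refine Nat.clog_le_of_le_pow ?_
  induction n, hn using Nat.le_induction with
  | base => norm_num
  | succ n hn ih =>
    have : 2 * n + 1 ≤ n ^ 2 := by nlinarith
    calc (n + 1) ^ 2 = n ^ 2 + (2 * n + 1) := by ring
      _ ≤ 2 ^ n + 2 ^ n := Nat.add_le_add ih (this.trans ih)
      _ = 2 ^ (n + 1) := by ring

/-- Sizes `0` and `1` contribute no member (`CliqueFree 0` fails). [folklore] -/
theorem not_mem_of_size_le_one {p : Σ n, SimpleGraph (Fin n)} (hp : p.1 ≤ 1) : p ∉ ramseySetAt thr := by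
  rintro ⟨h, -⟩
  have h0 : thr p.1 = 0 := by
    unfold thr
    exact Nat.clog_of_right_le_one (by nlinarith) 2
  rw [h0] at h
  exact SimpleGraph.not_cliqueFree_zero h

/-- Size `2` contributes no member: the unique pair is an edge of `G` or of `Gᶜ`. [folklore] -/
theorem not_mem_of_size_two (G : SimpleGraph (Fin 2)) :
    (⟨2, G⟩ : Σ n, SimpleGraph (Fin n)) ∉ ramseySetAt thr := by
  rintro ⟨h1, h2⟩
  have ht : thr 2 = 2 := by decide
  simp only [ht] at h1 h2
  rw [SimpleGraph.cliqueFree_two] at h1 h2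
  rw [h1, compl_bot] at h2
  have : (⊤ : SimpleGraph (Fin 2)).Adj 0 1 := by decide
  rw [h2] at this
  exact this

/-- EVERY graph on `3` vertices is a member (`thr 3 = 4 > 3`). [folklore] -/
theorem mem_of_size_three (G : SimpleGraph (Fin 3)) :
    (⟨3, G⟩ : Σ n, SimpleGraph (Fin n)) ∈ ramseySetAt thr := by
  have ht : thr 3 = 4 := by decide
  refine ⟨?_, ?_⟩ <;> simp only [ht] <;> exact SimpleGraph.cliqueFree_of_card_lt (by simp)

/-- The complete graph on `n` vertices has a `k`-clique for every `k ≤ n`. [folklore] -/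
theorem not_cliqueFree_top {n k : ℕ} (h : k ≤ n) : ¬ (⊤ : SimpleGraph (Fin n)).CliqueFree k := by
  have hc : (SimpleGraph.completeGraph (Fin k)).IsContained (SimpleGraph.completeGraph (Fin n)) :=
    (SimpleGraph.Embedding.completeGraph (Fin.castLEEmb h)).isContained
  simpa using hc.not_cliqueFree

/-- Complete graphs on `n ≥ 4` vertices are non-members. [folklore] -/
theorem top_not_mem {n : ℕ} (hn : 4 ≤ n) :
    (⟨n, ⊤⟩ : Σ n, SimpleGraph (Fin n)) ∉ ramseySetAt thr :=
  fun h => not_cliqueFree_top (thr_le_self hn) h.1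

/-! ## §2 Load-bearing, threshold from below: finite Ramsey languages are in `P` -/

/-- Finite languages are in `P` (hard-wire the members: `FP` is closed under finite patching).
[folklore] -/
theorem mem_P_of_finite {S : Language Bool} (hS : (S : Set (List Bool)).Finite) : S ∈ Classes.P := by
  classical
  have hlen : ∀ x ∈ S, x.length < hS.toFinset.sup List.length + 1 := fun x hx =>
    Nat.lt_succ_of_le (Finset.le_sup (f := List.length) (hS.mem_toFinset.2 hx))
  refine mem_P_of_mem_FP (g := fun x => if x ∈ S then [true] else [false]) ?_ S
    fun w => ⟨fun hw => if_pos hw, fun hw => if_neg hw⟩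
  exact mem_FP_of_eqOn_le (const_mem_FP [false]) (hS.toFinset.sup List.length + 1)
    fun z hz => if_neg fun hzS => absurd (hlen z hzS) (not_lt.2 hz)

/-- Finite languages are in `NP`. [folklore] -/
theorem mem_NP_of_finite {S : Language Bool} (hS : (S : Set (List Bool)).Finite) :
    S ∈ Nondeterministic.NP :=
  P_subset_NP_holds (mem_P_of_finite hS)

/-- Graphs of bounded size form a finite set. [folklore] -/
theorem finite_sizes_lt (N : ℕ) : {p : Σ n, SimpleGraph (Fin n) | p.1 < N}.Finite := by
  have h : {p : Σ n, SimpleGraph (Fin n) | p.1 < N} ⊆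
      ⋃ n ∈ Finset.range N, Set.range (fun G : SimpleGraph (Fin n) => (⟨n, G⟩ : Σ m, SimpleGraph (Fin m))) := by
    rintro ⟨n, G⟩ hn
    simp only [Set.mem_setOf_eq] at hn
    simp only [Set.mem_iUnion, Set.mem_range, Finset.mem_range]
    exact ⟨n, hn, G, rfl⟩
  exact Set.Finite.subset (Set.Finite.biUnion (Finset.range N).finite_toSet
    fun n _ => Set.finite_range _) h

/-- Complement commutes with pull-back along an injection. [folklore] -/
theorem compl_comap_eq {α β : Type*} (G : SimpleGraph β) (f : α ↪ β) :
    (G.comap f)ᶜ = Gᶜ.comap f := by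
  ext a b
  simp [SimpleGraph.compl_adj]

/-- **Erdős–Szekeres transported to `n ≥ 4^k` vertices**: every graph on `n ≥ 4^k` vertices has a
`k`-clique or a `k`-independent set (tree fact `ramsey_diagonal_le_four_pow_holds` on the first `4^k`
vertices). [folklore] -/
theorem not_ramsey_of_fourPow_le {n k : ℕ} (h : 4 ^ k ≤ n) (G : SimpleGraph (Fin n)) :
    ¬ (G.CliqueFree k ∧ Gᶜ.CliqueFree k) := by
  rintro ⟨hG, hGc⟩
  set f : Fin (4 ^ k) ↪ Fin n := Fin.castLEEmb h
  have hsub : (G.comap f).IsContained G := (SimpleGraph.Embedding.comap f G).isContained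
  have hsubc : (Gᶜ.comap f).IsContained Gᶜ := (SimpleGraph.Embedding.comap f Gᶜ).isContained
  rcases Literature.Combinatorics.SimpleGraph.ramsey_diagonal_le_four_pow_holds k (G.comap f) with h1 | h2
  · exact h1 (hG.comap hsub)
  · rw [compl_comap_eq] at h2
    exact h2 (hGc.comap hsubc)

/-- **LOAD-BEARING (threshold from below).** If `4^{k n} ≤ n` for all `n ≥ n₀`, the Ramsey set at
threshold `k` lives on fewer than `n₀` vertices. [folklore] -/
theorem ramseySetAt_subset_of_fourPow {k : ℕ → ℕ} {n₀ : ℕ} (hk : ∀ n ≥ n₀, 4 ^ k n ≤ n) :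
    ramseySetAt k ⊆ {p | p.1 < n₀} := by
  rintro ⟨n, G⟩ hp
  by_contra hn
  simp only [Set.mem_setOf_eq, not_lt] at hn
  exact not_ramsey_of_fourPow_le (hk n hn) G hp

/-- … hence is finite. [folklore] -/
theorem ramseySetAt_finite_of_fourPow {k : ℕ → ℕ} {n₀ : ℕ} (hk : ∀ n ≥ n₀, 4 ^ k n ≤ n) :
    (ramseySetAt k).Finite :=
  (finite_sizes_lt n₀).subset (ramseySetAt_subset_of_fourPow hk)

/-- A finite Ramsey set gives a finite language, which is in `NP`: the crux shape FAILS. [folklore] -/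
theorem not_ramseyNotNPAt_of_finite {k : ℕ → ℕ} (h : (ramseySetAt k).Finite) : ¬ RamseyNotNPAt k :=
  fun hX => hX (mem_NP_of_finite (h.image _))

/-- **`¬ RamseyNotNPAt k` whenever `4^{k n} ≤ n` eventually** (Erdős–Szekeres kills the threshold).
[folklore] -/
theorem not_ramseyNotNPAt_of_fourPow {k : ℕ → ℕ} {n₀ : ℕ} (hk : ∀ n ≥ n₀, 4 ^ k n ≤ n) :
    ¬ RamseyNotNPAt k :=
  not_ramseyNotNPAt_of_finite (ramseySetAt_finite_of_fourPow hk)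

/-- Every CONSTANT threshold is refuted (`R(c,c) ≤ 4^c`). [folklore] -/
theorem not_ramseyNotNPAt_const (c : ℕ) : ¬ RamseyNotNPAt (fun _ => c) :=
  not_ramseyNotNPAt_of_fourPow (n₀ := 4 ^ c) fun _ hn => hn

/-- The threshold `⌊log₄ n⌋` is refuted. [folklore] -/
theorem not_ramseyNotNPAt_log_four : ¬ RamseyNotNPAt (fun n => Nat.log 4 n) :=
  not_ramseyNotNPAt_of_fourPow (n₀ := 1) fun n hn => Nat.pow_log_le_self 4 (by omega)

/-- The threshold `⌊log₂ n⌋ / 2` ("`½ log₂ n`") is refuted: the constant `2` of the crux cannot be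
lowered to `1/2`. [folklore] -/
theorem not_ramseyNotNPAt_half_log_two : ¬ RamseyNotNPAt (fun n => Nat.log 2 n / 2) := by
  refine not_ramseyNotNPAt_of_fourPow (n₀ := 1) fun n hn => ?_
  calc 4 ^ (Nat.log 2 n / 2) = 2 ^ (2 * (Nat.log 2 n / 2)) := by rw [pow_mul]; norm_num
    _ ≤ 2 ^ Nat.log 2 n := Nat.pow_le_pow_right (by norm_num) (Nat.mul_div_le _ _)
    _ ≤ n := Nat.pow_log_le_self 2 (by omega)

/-! ## §3 Load-bearing, threshold from above: the trivial threshold gives the code-word language -/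

/-- If `n < k n` for all `n`, every graph is "Ramsey" at threshold `k`. [folklore] -/
theorem ramseySetAt_eq_univ_of_lt {k : ℕ → ℕ} (hk : ∀ n, n < k n) : ramseySetAt k = Set.univ := by
  refine Set.eq_univ_of_forall fun ⟨n, G⟩ => ⟨?_, ?_⟩ <;>
    exact SimpleGraph.cliqueFree_of_card_lt (by simpa using hk n)

/-- The set of graph code words is `HamNP.gcodeLang`, hence in `P`. [folklore] -/
theorem range_encode_eq_gcodeLang :
    (Set.range encodingGraph.encode : Language Bool) = HamNP.gcodeLang := by
  refine Set.ext fun x => ⟨?_, fun hx => ?_⟩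
  · rintro ⟨⟨n, G⟩, rfl⟩
    exact (HamNP.mem_gcodeLang_iff _).2 ⟨n, G, rfl⟩
  · obtain ⟨n, G, rfl⟩ := (HamNP.mem_gcodeLang_iff x).1 hx
    exact ⟨⟨n, G⟩, rfl⟩

/-- Graph code words form a `P` language. [folklore] -/
theorem range_encode_mem_P : (Set.range encodingGraph.encode : Language Bool) ∈ Classes.P :=
  range_encode_eq_gcodeLang ▸ HamNP.gcodeLang_mem_P

/-- **LOAD-BEARING (threshold from above).** `¬ RamseyNotNPAt k` whenever `n < k n` for all `n`: the
language is the code-word language. [folklore] -/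
theorem not_ramseyNotNPAt_of_lt {k : ℕ → ℕ} (hk : ∀ n, n < k n) : ¬ RamseyNotNPAt k := by
  intro hX
  apply hX
  have : ramseyLangAt k = Set.range encodingGraph.encode := by
    rw [ramseyLangAt, ramseySetAt_eq_univ_of_lt hk, Encoding.toLanguage, Set.image_univ]
  rw [this]
  exact P_subset_NP_holds range_encode_mem_P

/-! ## §4 Only the eventual behaviour of the threshold matters -/

/-- **`NP` is closed under finite modification**: if `L ∈ NP` and `L'` differs from `L` on a finite set,
then `L' ∈ NP` (`L' = (F₁ ⊔ L) ⊓ F₂ᶜ` with `F₁ = L' \ L`, `F₂ = L \ L'` finite, hence in `P`).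
[folklore] -/
theorem mem_NP_of_finite_modification {L L' : Language Bool} (hL : L ∈ Nondeterministic.NP)
    (h₁ : (L' \ L : Set (List Bool)).Finite) (h₂ : (L \ L' : Set (List Bool)).Finite) :
    L' ∈ Nondeterministic.NP := by
  have heq : L' = ((L \ L' : Set (List Bool)) : Language Bool)ᶜ ⊓ (((L' \ L : Set (List Bool)) : Language Bool) ⊔ L) := by
    ext x
    change x ∈ L' ↔ ¬ (x ∈ L ∧ x ∉ L') ∧ ((x ∈ L' ∧ x ∉ L) ∨ x ∈ L)
    tauto
  rw [heq]
  refine inter_P_mem_polyExists (K := Classes.P) (fun _ _ a b => inter_mem_P a b)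
    (compl_mem_P_iff.2 (mem_P_of_finite h₂)) ?_
  exact union_P_mem_polyExists (K := Classes.P) (fun _ _ a b => union_mem_P a b) (mem_P_of_finite h₁) hL

/-- Two thresholds that eventually agree define languages with finite symmetric difference. [folklore] -/
theorem ramseyLangAt_diff_finite {k k' : ℕ → ℕ} {n₀ : ℕ} (h : ∀ n ≥ n₀, k n = k' n) :
    (ramseyLangAt k \ ramseyLangAt k' : Set (List Bool)).Finite := by
  have hsub : (ramseyLangAt k \ ramseyLangAt k' : Set (List Bool)) ⊆
      encodingGraph.encode '' {p : Σ n, SimpleGraph (Fin n) | p.1 < n₀} := by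
    rintro x ⟨⟨p, hp, rfl⟩, hx⟩
    refine ⟨p, ?_, rfl⟩
    simp only [Set.mem_setOf_eq]
    by_contra hn
    apply hx
    refine ⟨p, ?_, rfl⟩
    have e := h p.1 (not_lt.1 hn)
    simp only [ramseySetAt, Set.mem_setOf_eq] at hp ⊢
    rw [← e]
    exact hp
  exact ((finite_sizes_lt n₀).image _).subset hsub

/-- **Eventual invariance.** If `k n = k' n` for all `n ≥ n₀` then `RamseyNotNPAt k ↔ RamseyNotNPAt k'`.
[folklore] -/
theorem ramseyNotNPAt_congr {k k' : ℕ → ℕ} {n₀ : ℕ} (h : ∀ n ≥ n₀, k n = k' n) :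
    RamseyNotNPAt k ↔ RamseyNotNPAt k' := by
  have h' : ∀ n ≥ n₀, k' n = k n := fun n hn => (h n hn).symm
  exact not_congr ⟨fun hk => mem_NP_of_finite_modification hk (ramseyLangAt_diff_finite h')
      (ramseyLangAt_diff_finite h),
    fun hk' => mem_NP_of_finite_modification hk' (ramseyLangAt_diff_finite h)
      (ramseyLangAt_diff_finite h')⟩

/-- Eventual form of §3: `n < k n` for all LARGE `n` already refutes the threshold. [folklore] -/
theorem not_ramseyNotNPAt_of_eventually_lt {k : ℕ → ℕ} {n₀ : ℕ} (hk : ∀ n ≥ n₀, n < k n) :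
    ¬ RamseyNotNPAt k := by
  rw [ramseyNotNPAt_congr (k' := fun n => if n₀ ≤ n then k n else n + 1) (n₀ := n₀)
    (fun n hn => by simp [hn])]
  refine not_ramseyNotNPAt_of_lt fun n => ?_
  by_cases hn : n₀ ≤ n
  · simpa [hn] using hk n hn
  · simp [hn]

/-! ## §5 Necessary conditions: an NP-outsider is infinite and co-infinite among code words -/

/-- If `RAMSEY_k ∉ NP` then the language is infinite. [folklore] -/
theorem infinite_of_ramseyNotNPAt {k : ℕ → ℕ} (h : RamseyNotNPAt k) : (ramseyLangAt k : Set (List Bool)).Infinite :=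
  fun hfin => h (mem_NP_of_finite hfin)

/-- If `RAMSEY_k ∉ NP` then infinitely many code words lie outside the language. [folklore] -/
theorem coinfinite_of_ramseyNotNPAt {k : ℕ → ℕ} (h : RamseyNotNPAt k) :
    (Set.range encodingGraph.encode \ ramseyLangAt k : Set (List Bool)).Infinite := by
  intro hfin
  apply h
  have heq : ramseyLangAt k = (Set.range encodingGraph.encode : Language Bool) ⊓
      ((Set.range encodingGraph.encode \ ramseyLangAt k : Set (List Bool)) : Language Bool)ᶜ := by
    ext x
    change x ∈ ramseyLangAt k ↔ x ∈ Set.range encodingGraph.encode ∧ ¬ (x ∈ Set.range encodingGraph.encode ∧ x ∉ ramseyLangAt k)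
    constructor
    · intro hx
      refine ⟨?_, fun h' => h'.2 hx⟩
      obtain ⟨p, -, rfl⟩ := hx
      exact ⟨p, rfl⟩
    · rintro ⟨hx, h'⟩
      by_contra hx'
      exact h' ⟨hx, hx'⟩
  rw [heq]
  exact P_subset_NP_holds (inter_mem_P range_encode_mem_P (compl_mem_P_iff.2 (mem_P_of_finite hfin)))

/-! ## §7 Instance form of the crux -/

/-- **Instance form.** `RAMSEY_k ∉ NP` iff EVERY `NP` language made of (codes of) `k`-Ramsey graphs misses
infinitely many of them — "no sound NP proof system for Ramsey-ness is complete up to finitely many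
exceptions".  (`→`: finite modification, §4; `←`: take the language itself.) [folklore] -/
theorem ramseyNotNPAt_iff_forall_NP_misses_infinite {k : ℕ → ℕ} :
    RamseyNotNPAt k ↔ ∀ L ∈ Nondeterministic.NP, L ≤ ramseyLangAt k →
      ((ramseyLangAt k : Set (List Bool)) \ L).Infinite := by
  constructor
  · intro hX L hL hsub hfin
    refine hX (mem_NP_of_finite_modification hL hfin ?_)
    refine Set.Finite.subset Set.finite_empty ?_
    rintro x ⟨hxL, hxR⟩
    exact (hxR (hsub hxL)).elim
  · intro h hX
    refine h _ hX le_rfl (Set.finite_empty.subset ?_)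
    rintro x ⟨hx, hx'⟩
    exact (hx' hx).elim

/-- The universal closure of the crux shape over thresholds is FALSE (already the constant threshold `0`
gives the empty language). [folklore] -/
theorem not_forall_threshold : ¬ ∀ k : ℕ → ℕ, RamseyNotNPAt k := fun h => not_ramseyNotNPAt_const 0 (h _)


end Summit.PneNP.PneNP.Theorems.RamseyNotNP.Negative
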